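import Mathlib
import Summits.Ventures.HodgeRepro2.Tier7.Line3.AdicCompletionInvolution
import Summits.Ventures.HodgeRepro2.Tier7.Line3.AdicValuationInvariant
import Summits.Ventures.HodgeRepro2.Tier7.Line3.AdicValuationInvariantPrimesOver
import Summits.Ventures.HodgeRepro2.Tier7.Line3.AdicCompletionLevel
import Summits.Ventures.HodgeRepro2.Tier7.Line3.CharacterLocallyConstant
import Summits.Ventures.HodgeRepro2.Tier7.Line3.TorusIntegral
import Summits.Ventures.HodgeRepro2.T7SupportRegularStabilizer
import Summits.Ventures.HodgeRepro2.T7SupportRegularTransport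

/-!
# Tier7/Line3/LevelPlaceAssembly — the level-place chain assembled at Mathlib's completion, every discharge composed
(seat t7-L1-p4, gen 5; assigned by t7-plan-3, STATUS l. 15838 (1); ruling l. 15863 (2): `hσσ` is NOT displayed)

LINE 3 (t7-plan-3), version (ii). ConcreteLevelFactor p698828's theorem `concrete_kappaData_b_fields` — the three
`b`-fields of `KappaData` at the level place on the concrete model — is restated ONCE MORE, at Mathlib's completion
`F := w.adicCompletion E` of the number field `E` at the prime `w` (x1's AdicCompletionLocalField p703140: `ProperSpace`
and `IsUltrametricDist` are instances there), with EVERY discharge of the level-place rows composed into one consumer: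

* `σ := completionMap w σ hσ` (x1's AdicCompletionInvolution p703979): the continuity and isometry clauses `hσc`, `hσn`
  are theorems (`continuous_completionMap`, `norm_completionMap`); in the Galois form `levelPlace_assembly_galois` the
  clause `hσ` itself (valuation-preservation of `σ : E ≃ₐ[K] E` at `w`) is a theorem of `hw` («`w` lies over `v`») and
  `huniq` («`w` is the ONLY prime of `E` above `v`» — the inert `v₁` of the dictionary) by x1's AdicValuationInvariant
  `valuation_galRestrict` (AdicValuationInvariant p704731);
* the integrality clauses `hB`, `hB'` (the second torus inside the integral matrices) are theorems of the datum
  «`P` integral-unimodular» — `hPint`, `hPinv` — by L1-p2's TorusIntegral `hB_of_integral` / `hB'_of_integral`, and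
  `loc := GeneralLinearGroup.map (algebraMap E (w.adicCompletion E))` at `Orb := GL (Fin 2) E` is Mathlib's map
  (L1-p2's `coe_GL_map`: «`loc γ = (matO γ).map ψ` as a unit», cited not re-declared) — both through L1-p2's consumer
  `concrete_kappaData_b_fields_of_integral`;
* the four character clauses `hχA`, `hψB` (unitarity), `hχA'`, `hψB'` (local constancy) are theorems of
  `Continuous χA`, `Continuous ψB` (this seat's CharacterLocallyConstant p704191);
* `hmatch` (the central match on the stabiliser of the dominant coset) is a theorem of `Regular P (loc γ₀)` and the
  central match `hC` on the norm-one scalars (p1's T7SupportRegularStabilizer p704361 `hmatch_of_central`); in the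
  global-basis form §4 the LOCAL regularity `Regular P (loc γ₀)` is itself a theorem of the GLOBAL `Regular P₀ γ₀`
  (p1's T7SupportRegularTransport p705857 `regular_GL_map_iff`, row 722) when `P = GeneralLinearGroup.map _ P₀`.

WHAT REMAINS DISPLAYED = the [W] column of record reduced to DATUM sentences (the paper note
proofs/t7/L3/ASSEMBLY-p4.md lists, per hypothesis, the dictionary sentence it stands for): the number field `E` with
its prime `w` (Galois form: `K`, `σ : E ≃ₐ[K] E`, `v`, `hw`, `huniq`); the second basis `f` with its matrix `P` (`hP`)
and the datum «`P`, `P⁻¹` integral» (`hPint`, `hPinv`); `q` with `1 < q` (x1's AdicCompletionLevel row sets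
`q := q v`, the residue cardinality, on its landing — the theorem is stated for any `q`); the continuous characters
`χA`, `ψB`; the dominant representative `γ₀ : GL (Fin 2) E` with `Regular P (loc γ₀)` (§4: `Regular P₀ γ₀`, global) and
`hC`; the data away from `v₁` (`arithS`, `bS` with its three clauses). Four forms: §1 `levelPlace_assembly` (any
valuation-preserving `σ : E →+* E`, `hσ` in the `∀ x` form consumed by `completionMap`), §2 `levelPlace_assembly_galois`
(`σ ∈ Gal(E/K)`, `hw`, `huniq`), §3 `levelPlace_assembly_inert` (`[w.asIdeal.LiesOver v.asIdeal]`, `ncard = 1`,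
`q := q w`), §4 `levelPlace_assembly_global` (§3 with the global basis `P₀` and the global regularity) — 2 definitions
(`sigmaGalois`, `sigmaInert`) + 4 theorems. The involutivity `σ ∘ σ = id` is NOT displayed: no clause consumes it
(plan-3's ruling l. 15863 (2)); it lives in the identification sentence «`σ` = the Galois involution of `E/E⁺`».
The conclusion is VERBATIM p698828's (the 15-clause `∃`, with `D.loc = GeneralLinearGroup.map _` as in L1-p2's row).
[M]-level; NOT distance to (P); residual (a′)/(b′) unchanged in kind; LEMMAS CLOSING THE STEP 0. Nothing here is about
(N), (P), the real `X`, or HC_CM; §8(d): NO.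
Blind lane: Mathlib + the HodgeRepro2 prefix; no sorry; axioms ⊆ {propext, Classical.choice, Quot.sound}.
-/

namespace Summit.Ventures.HodgeRepro2.Tier7.Line3.LevelPlaceAssembly

open IsDedekindDomain IsDedekindDomain.HeightOneSpectrum NumberField
open scoped NumberField
open Matrix MeasureTheory
  Summit.Ventures.HodgeRepro2.T7SupportTwoTorusInvariant
  Summit.Ventures.HodgeRepro2.T7SupportRegularStabilizer
  Summit.Ventures.HodgeRepro2.T7SupportRegularTransport
  Summit.Ventures.HodgeRepro2.Tier7.Line3.CongruenceSubgroup
  Summit.Ventures.HodgeRepro2.Tier7.Line3.TorusSupport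
  Summit.Ventures.HodgeRepro2.Tier7.Line3.LevelTowerTopology
  Summit.Ventures.HodgeRepro2.Tier7.Line3.LevelFactor
  Summit.Ventures.HodgeRepro2.Tier7.Line3.AdicCompletionInvolution
  Summit.Ventures.HodgeRepro2.Tier7.Line3.AdicValuationInvariant
  Summit.Ventures.HodgeRepro2.Tier7.Line3.CharacterLocallyConstant
  Summit.Ventures.HodgeRepro2.Tier7.Line3.TorusIntegral

/-! ## §1 The assembly for a valuation-preserving `σ : E →+* E` -/

section core

variable {E : Type*} [Field E] [NumberField E] (w : HeightOneSpectrum (𝓞 E)) (σ : E →+* E)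
  (hσ : ∀ x, w.valuation E (σ x) = w.valuation E x)

/-- **THE LEVEL-PLACE ASSEMBLY**: p698828's three `b`-fields at `F := w.adicCompletion E`, `σ := completionMap w σ hσ`,
`loc := GeneralLinearGroup.map (algebraMap E (w.adicCompletion E))`, `Orb := GL (Fin 2) E`, with the instance clauses
(p703140), `hσc` / `hσn` (p703979), `hB` / `hB'` (L1-p2's TorusIntegral), the four character clauses (p704191) and
`hmatch` (p704361) all DISCHARGED; what is displayed is the datum only (the list in the module docstring). -/
theorem levelPlace_assembly
    (f : Fin 2 → Fin 2 → w.adicCompletion E) (P : GL (Fin 2) (w.adicCompletion E))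
    (hP : ∀ j, (P : Matrix (Fin 2) (Fin 2) (w.adicCompletion E)).col j = f j)
    (hPint : EntryLE normAbv 1 (P : Matrix (Fin 2) (Fin 2) (w.adicCompletion E)))
    (hPinv : EntryLE normAbv 1 ((P⁻¹ : GL (Fin 2) (w.adicCompletion E)) : Matrix (Fin 2) (Fin 2) (w.adicCompletion E)))
    {q : ℝ} (hq : 1 < q)
    (χA : torusA (completionMap w σ hσ) →* ℂ) (ψB : torusB (completionMap w σ hσ) f →* ℂ)
    (hχc : Continuous χA) (hψc : Continuous ψB)
    (γ₀ : GL (Fin 2) E) (hreg : Regular P (GeneralLinearGroup.map (algebraMap E (w.adicCompletion E)) γ₀))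
    (hC : ∀ (z : w.adicCompletion E) (hz : nrm (completionMap w σ hσ) z = 1),
      χA (scalarA (completionMap w σ hσ) z hz) * ψB (scalarB (completionMap w σ hσ) f z hz) = 1)
    (arithS : GL (Fin 2) E → Prop) (bS : GL (Fin 2) E → ℂ) (bS_support : ∀ γ, bS γ ≠ 0 → arithS γ) (C : ℝ)
    (size : GL (Fin 2) E → ℝ) (ε : ℝ)
    (bS_bound : ∀ γ, arithS γ → ‖bS γ‖ ≤ C * (1 + size γ) ^ ε * ‖bS γ₀‖) (bS_γ₀ : bS γ₀ ≠ 0) :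
    ∃ (mA : MeasurableSpace (torusA (completionMap w σ hσ)))
      (mB : MeasurableSpace (torusB (completionMap w σ hσ) f))
      (μA : Measure (torusA (completionMap w σ hσ))) (μB : Measure (torusB (completionMap w σ hσ) f))
      (D : LevelFactorData (torusA (completionMap w σ hσ)) (torusB (completionMap w σ hσ) f)
        (GL (Fin 2) (w.adicCompletion E)) (GL (Fin 2) E) μA μB),
      (@BorelSpace (torusA (completionMap w σ hσ)) _ mA) ∧
      (@BorelSpace (torusB (completionMap w σ hσ) f) _ mB) ∧
      μA.IsHaarMeasure ∧ μB.IsHaarMeasure ∧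
      D.ιA = iotaA (completionMap w σ hσ) ∧ D.ιB = iotaB (completionMap w σ hσ) f ∧
      D.K = levelTower normAbv isNonarchimedean_normAbv hq ∧
      D.loc = GeneralLinearGroup.map (algebraMap E (w.adicCompletion E)) ∧ D.γ₀ = γ₀ ∧ D.arithS = arithS ∧
      D.bS = bS ∧ D.size = size ∧ D.ε = ε ∧
      (∀ N γ, D.b N γ ≠ 0 → D.arith N γ) ∧
      (∃ Bb : ℝ, ∀ N γ, D.arith N γ → ‖D.b N γ‖ ≤ Bb * (1 + D.size γ) ^ D.ε * ‖D.b N D.γ₀‖) ∧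
      (∃ N₀ : ℕ, ∀ N ≥ N₀, D.b N D.γ₀ ≠ 0) :=
  concrete_kappaData_b_fields_of_integral (completionMap w σ hσ) f P (continuous_completionMap w σ hσ)
    (norm_completionMap w σ hσ) hP hPint hPinv hq (algebraMap E (w.adicCompletion E)) χA ψB
    (norm_apply_eq_one_torusA _ (continuous_completionMap w σ hσ) (norm_completionMap w σ hσ) χA hχc)
    (norm_apply_eq_one_torusB _ (continuous_completionMap w σ hσ) (norm_completionMap w σ hσ) f P hP ψB hψc)
    (isLocallyConstant_torusA _ (continuous_completionMap w σ hσ) (norm_completionMap w σ hσ) χA hχc)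
    (isLocallyConstant_torusB _ (continuous_completionMap w σ hσ) (norm_completionMap w σ hσ) f P hP ψB hψc)
    γ₀ (hmatch_of_central _ f hP (GeneralLinearGroup.map (algebraMap E (w.adicCompletion E))) γ₀ hreg χA ψB hC)
    arithS bS bS_support C size ε bS_bound bS_γ₀

end core

/-! ## §2 The Galois form: `σ ∈ Gal(E/K)`, `w` the only prime of `E` above `v` -/

section galois

variable {K E : Type*} [Field K] [NumberField K] [Field E] [NumberField E] [Algebra K E]
  (w : HeightOneSpectrum (𝓞 E)) (σ : E ≃ₐ[K] E) (v : HeightOneSpectrum (𝓞 K))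
  (hw : w.asIdeal.comap (algebraMap (𝓞 K) (𝓞 E)) = v.asIdeal)
  (huniq : ∀ w' : HeightOneSpectrum (𝓞 E), w'.asIdeal.comap (algebraMap (𝓞 K) (𝓞 E)) = v.asIdeal → w' = w)

/-- **the isometric extension of the Galois element to `E_w`**: x1's `completionMap` at the valuation-preservation
supplied by x1's `valuation_galRestrict` (`w` the only prime of `E` above `v`). -/
noncomputable def sigmaGalois : w.adicCompletion E →+* w.adicCompletion E :=
  completionMap w (σ : E →+* E) (valuation_galRestrict w σ v hw huniq)

/-- **THE LEVEL-PLACE ASSEMBLY, GALOIS FORM**: `levelPlace_assembly` at `σ := sigmaGalois w σ v hw huniq` — the clause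
`hσ` is gone; the datum displayed about `σ` is `(K, σ ∈ Gal(E/K), v, w, hw, huniq)` only. -/
theorem levelPlace_assembly_galois
    (f : Fin 2 → Fin 2 → w.adicCompletion E) (P : GL (Fin 2) (w.adicCompletion E))
    (hP : ∀ j, (P : Matrix (Fin 2) (Fin 2) (w.adicCompletion E)).col j = f j)
    (hPint : EntryLE normAbv 1 (P : Matrix (Fin 2) (Fin 2) (w.adicCompletion E)))
    (hPinv : EntryLE normAbv 1 ((P⁻¹ : GL (Fin 2) (w.adicCompletion E)) : Matrix (Fin 2) (Fin 2) (w.adicCompletion E)))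
    {q : ℝ} (hq : 1 < q)
    (χA : torusA (sigmaGalois w σ v hw huniq) →* ℂ) (ψB : torusB (sigmaGalois w σ v hw huniq) f →* ℂ)
    (hχc : Continuous χA) (hψc : Continuous ψB)
    (γ₀ : GL (Fin 2) E) (hreg : Regular P (GeneralLinearGroup.map (algebraMap E (w.adicCompletion E)) γ₀))
    (hC : ∀ (z : w.adicCompletion E) (hz : nrm (sigmaGalois w σ v hw huniq) z = 1),
      χA (scalarA (sigmaGalois w σ v hw huniq) z hz) * ψB (scalarB (sigmaGalois w σ v hw huniq) f z hz) = 1)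
    (arithS : GL (Fin 2) E → Prop) (bS : GL (Fin 2) E → ℂ) (bS_support : ∀ γ, bS γ ≠ 0 → arithS γ) (C : ℝ)
    (size : GL (Fin 2) E → ℝ) (ε : ℝ)
    (bS_bound : ∀ γ, arithS γ → ‖bS γ‖ ≤ C * (1 + size γ) ^ ε * ‖bS γ₀‖) (bS_γ₀ : bS γ₀ ≠ 0) :
    ∃ (mA : MeasurableSpace (torusA (sigmaGalois w σ v hw huniq)))
      (mB : MeasurableSpace (torusB (sigmaGalois w σ v hw huniq) f))
      (μA : Measure (torusA (sigmaGalois w σ v hw huniq))) (μB : Measure (torusB (sigmaGalois w σ v hw huniq) f))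
      (D : LevelFactorData (torusA (sigmaGalois w σ v hw huniq)) (torusB (sigmaGalois w σ v hw huniq) f)
        (GL (Fin 2) (w.adicCompletion E)) (GL (Fin 2) E) μA μB),
      (@BorelSpace (torusA (sigmaGalois w σ v hw huniq)) _ mA) ∧
      (@BorelSpace (torusB (sigmaGalois w σ v hw huniq) f) _ mB) ∧
      μA.IsHaarMeasure ∧ μB.IsHaarMeasure ∧
      D.ιA = iotaA (sigmaGalois w σ v hw huniq) ∧ D.ιB = iotaB (sigmaGalois w σ v hw huniq) f ∧
      D.K = levelTower normAbv isNonarchimedean_normAbv hq ∧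
      D.loc = GeneralLinearGroup.map (algebraMap E (w.adicCompletion E)) ∧ D.γ₀ = γ₀ ∧ D.arithS = arithS ∧
      D.bS = bS ∧ D.size = size ∧ D.ε = ε ∧
      (∀ N γ, D.b N γ ≠ 0 → D.arith N γ) ∧
      (∃ Bb : ℝ, ∀ N γ, D.arith N γ → ‖D.b N γ‖ ≤ Bb * (1 + D.size γ) ^ D.ε * ‖D.b N D.γ₀‖) ∧
      (∃ N₀ : ℕ, ∀ N ≥ N₀, D.b N D.γ₀ ≠ 0) :=
  levelPlace_assembly w (σ : E →+* E) (valuation_galRestrict w σ v hw huniq) f P hP hPint hPinv hq χA ψB hχc hψc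
    γ₀ hreg hC arithS bS bS_support C size ε bS_bound bS_γ₀

end galois


/-! ## §3 The inert form: `w` the only prime above `v` in Mathlib's vocabulary, `q := q w` the residue cardinality -/

section inert

open Summit.Ventures.HodgeRepro2.Tier7.Line3.AdicCompletionLevel

variable {K E : Type*} [Field K] [NumberField K] [Field E] [NumberField E] [Algebra K E]
  (w : HeightOneSpectrum (𝓞 E)) (σ : E ≃ₐ[K] E) (v : HeightOneSpectrum (𝓞 K)) [w.asIdeal.LiesOver v.asIdeal]
  (hone : (Ideal.primesOver v.asIdeal (𝓞 E)).ncard = 1)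

/-- **the isometric extension of the Galois element at the inert place, Mathlib's vocabulary**: `completionMap` at the
valuation-preservation supplied by x1's bridge `valuation_galRestrict_of_ncard_eq_one` (`w` lies over `v`, exactly
one prime of `E` above `v`). -/
noncomputable def sigmaInert : w.adicCompletion E →+* w.adicCompletion E :=
  completionMap w (σ : E →+* E) (valuation_galRestrict_of_ncard_eq_one w v σ hone)

/-- **THE LEVEL-PLACE ASSEMBLY, INERT FORM**: `levelPlace_assembly` at `σ := sigmaInert w σ v hone` and
`q := q w = |𝓞 E ⧸ w|` (x1's AdicCompletionLevel: the level tower is then the principal congruence tower of level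
`𝔭^(N+1)`) — the datum displayed about the place is `(v, w, [w.asIdeal.LiesOver v.asIdeal], primesOver v (𝓞 E) has
one element)` and no `q`, no `hq`, no `hσ`. -/
theorem levelPlace_assembly_inert
    (f : Fin 2 → Fin 2 → w.adicCompletion E) (P : GL (Fin 2) (w.adicCompletion E))
    (hP : ∀ j, (P : Matrix (Fin 2) (Fin 2) (w.adicCompletion E)).col j = f j)
    (hPint : EntryLE normAbv 1 (P : Matrix (Fin 2) (Fin 2) (w.adicCompletion E)))
    (hPinv : EntryLE normAbv 1 ((P⁻¹ : GL (Fin 2) (w.adicCompletion E)) : Matrix (Fin 2) (Fin 2) (w.adicCompletion E)))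
    (χA : torusA (sigmaInert w σ v hone) →* ℂ) (ψB : torusB (sigmaInert w σ v hone) f →* ℂ)
    (hχc : Continuous χA) (hψc : Continuous ψB)
    (γ₀ : GL (Fin 2) E) (hreg : Regular P (GeneralLinearGroup.map (algebraMap E (w.adicCompletion E)) γ₀))
    (hC : ∀ (z : w.adicCompletion E) (hz : nrm (sigmaInert w σ v hone) z = 1),
      χA (scalarA (sigmaInert w σ v hone) z hz) * ψB (scalarB (sigmaInert w σ v hone) f z hz) = 1)
    (arithS : GL (Fin 2) E → Prop) (bS : GL (Fin 2) E → ℂ) (bS_support : ∀ γ, bS γ ≠ 0 → arithS γ) (C : ℝ)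
    (size : GL (Fin 2) E → ℝ) (ε : ℝ)
    (bS_bound : ∀ γ, arithS γ → ‖bS γ‖ ≤ C * (1 + size γ) ^ ε * ‖bS γ₀‖) (bS_γ₀ : bS γ₀ ≠ 0) :
    ∃ (mA : MeasurableSpace (torusA (sigmaInert w σ v hone)))
      (mB : MeasurableSpace (torusB (sigmaInert w σ v hone) f))
      (μA : Measure (torusA (sigmaInert w σ v hone))) (μB : Measure (torusB (sigmaInert w σ v hone) f))
      (D : LevelFactorData (torusA (sigmaInert w σ v hone)) (torusB (sigmaInert w σ v hone) f)
        (GL (Fin 2) (w.adicCompletion E)) (GL (Fin 2) E) μA μB),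
      (@BorelSpace (torusA (sigmaInert w σ v hone)) _ mA) ∧
      (@BorelSpace (torusB (sigmaInert w σ v hone) f) _ mB) ∧
      μA.IsHaarMeasure ∧ μB.IsHaarMeasure ∧
      D.ιA = iotaA (sigmaInert w σ v hone) ∧ D.ιB = iotaB (sigmaInert w σ v hone) f ∧
      D.K = levelTower normAbv isNonarchimedean_normAbv (one_lt_q w) ∧
      D.loc = GeneralLinearGroup.map (algebraMap E (w.adicCompletion E)) ∧ D.γ₀ = γ₀ ∧ D.arithS = arithS ∧
      D.bS = bS ∧ D.size = size ∧ D.ε = ε ∧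
      (∀ N γ, D.b N γ ≠ 0 → D.arith N γ) ∧
      (∃ Bb : ℝ, ∀ N γ, D.arith N γ → ‖D.b N γ‖ ≤ Bb * (1 + D.size γ) ^ D.ε * ‖D.b N D.γ₀‖) ∧
      (∃ N₀ : ℕ, ∀ N ≥ N₀, D.b N D.γ₀ ≠ 0) :=
  levelPlace_assembly w (σ : E →+* E) (valuation_galRestrict_of_ncard_eq_one w v σ hone) f P hP hPint hPinv
    (one_lt_q w) χA ψB hχc hψc γ₀ hreg hC arithS bS bS_support C size ε bS_bound bS_γ₀

end inert


/-! ## §4 The global basis: `P := GeneralLinearGroup.map _ P₀`, regularity of the GLOBAL `γ₀` (p1's row 722) -/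

section globalBasis

open Summit.Ventures.HodgeRepro2.Tier7.Line3.AdicCompletionLevel

variable {K E : Type*} [Field K] [NumberField K] [Field E] [NumberField E] [Algebra K E]
  (w : HeightOneSpectrum (𝓞 E)) (σ : E ≃ₐ[K] E) (v : HeightOneSpectrum (𝓞 K)) [w.asIdeal.LiesOver v.asIdeal]
  (hone : (Ideal.primesOver v.asIdeal (𝓞 E)).ncard = 1)

/-- **THE LEVEL-PLACE ASSEMBLY, GLOBAL-BASIS FORM**: `levelPlace_assembly_inert` with the local basis matrix the image
`GeneralLinearGroup.map (algebraMap E (w.adicCompletion E)) P₀` of a GLOBAL `P₀ : GL (Fin 2) E` and the regularity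
hypothesis on the GLOBAL `γ₀` — `Regular P₀ γ₀` — transported by p1's `regular_GL_map_iff` (row 722): the
[W] clause «loc γ₀ is regular» is relocated to «the global γ₀ is regular» (κ(γ₀) ∉ {0,1}, the choice of (b′)). -/
theorem levelPlace_assembly_global (P₀ : GL (Fin 2) E) (f : Fin 2 → Fin 2 → w.adicCompletion E)
    (hP : ∀ j, ((GeneralLinearGroup.map (algebraMap E (w.adicCompletion E)) P₀ : GL (Fin 2) (w.adicCompletion E)) :
      Matrix (Fin 2) (Fin 2) (w.adicCompletion E)).col j = f j)
    (hPint : EntryLE normAbv 1 ((GeneralLinearGroup.map (algebraMap E (w.adicCompletion E)) P₀ :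
      GL (Fin 2) (w.adicCompletion E)) : Matrix (Fin 2) (Fin 2) (w.adicCompletion E)))
    (hPinv : EntryLE normAbv 1 (((GeneralLinearGroup.map (algebraMap E (w.adicCompletion E)) P₀)⁻¹ :
      GL (Fin 2) (w.adicCompletion E)) : Matrix (Fin 2) (Fin 2) (w.adicCompletion E)))
    (χA : torusA (sigmaInert w σ v hone) →* ℂ) (ψB : torusB (sigmaInert w σ v hone) f →* ℂ)
    (hχc : Continuous χA) (hψc : Continuous ψB)
    (γ₀ : GL (Fin 2) E) (hreg : Regular P₀ γ₀)
    (hC : ∀ (z : w.adicCompletion E) (hz : nrm (sigmaInert w σ v hone) z = 1),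
      χA (scalarA (sigmaInert w σ v hone) z hz) * ψB (scalarB (sigmaInert w σ v hone) f z hz) = 1)
    (arithS : GL (Fin 2) E → Prop) (bS : GL (Fin 2) E → ℂ) (bS_support : ∀ γ, bS γ ≠ 0 → arithS γ) (C : ℝ)
    (size : GL (Fin 2) E → ℝ) (ε : ℝ)
    (bS_bound : ∀ γ, arithS γ → ‖bS γ‖ ≤ C * (1 + size γ) ^ ε * ‖bS γ₀‖) (bS_γ₀ : bS γ₀ ≠ 0) :
    ∃ (mA : MeasurableSpace (torusA (sigmaInert w σ v hone)))
      (mB : MeasurableSpace (torusB (sigmaInert w σ v hone) f))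
      (μA : Measure (torusA (sigmaInert w σ v hone))) (μB : Measure (torusB (sigmaInert w σ v hone) f))
      (D : LevelFactorData (torusA (sigmaInert w σ v hone)) (torusB (sigmaInert w σ v hone) f)
        (GL (Fin 2) (w.adicCompletion E)) (GL (Fin 2) E) μA μB),
      (@BorelSpace (torusA (sigmaInert w σ v hone)) _ mA) ∧
      (@BorelSpace (torusB (sigmaInert w σ v hone) f) _ mB) ∧
      μA.IsHaarMeasure ∧ μB.IsHaarMeasure ∧
      D.ιA = iotaA (sigmaInert w σ v hone) ∧ D.ιB = iotaB (sigmaInert w σ v hone) f ∧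
      D.K = levelTower normAbv isNonarchimedean_normAbv (one_lt_q w) ∧
      D.loc = GeneralLinearGroup.map (algebraMap E (w.adicCompletion E)) ∧ D.γ₀ = γ₀ ∧ D.arithS = arithS ∧
      D.bS = bS ∧ D.size = size ∧ D.ε = ε ∧
      (∀ N γ, D.b N γ ≠ 0 → D.arith N γ) ∧
      (∃ Bb : ℝ, ∀ N γ, D.arith N γ → ‖D.b N γ‖ ≤ Bb * (1 + D.size γ) ^ D.ε * ‖D.b N D.γ₀‖) ∧
      (∃ N₀ : ℕ, ∀ N ≥ N₀, D.b N D.γ₀ ≠ 0) :=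
  levelPlace_assembly_inert w σ v hone f (GeneralLinearGroup.map (algebraMap E (w.adicCompletion E)) P₀) hP hPint
    hPinv χA ψB hχc hψc γ₀ ((regular_GL_map_iff (algebraMap E (w.adicCompletion E)) γ₀ P₀).2 hreg) hC arithS bS
    bS_support C size ε bS_bound bS_γ₀

end globalBasis

end Summit.Ventures.HodgeRepro2.Tier7.Line3.LevelPlaceAssembly
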